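/-
Copyright (c) 2026. All rights reserved.
Released under Apache 2.0 license as described in the file LICENSE.
Authors: abc-iut cell, prover seat abc-iut-w4-d017 (wave 4, gen 5).
-/
import Literature.IUT.LogVolume.UnitLogBallTorsionCensus
import Literature.IUT.LogVolume.LogSeriesDominantTerm
import Literature.IUT.LogVolume.UnitLogWildDyadicInhabited
import HarnessLib

/-!
# Dyadic fields with `e ≥ 3`, `e ≠ 4` (or `e` even, `f ≥ 2`): NO ball is a `2^k · log₂(𝒪_K^×)`

Proof-only file (theorems, no definitions).  Classical `2`-adic analysis (Neukirch, *Algebraic Number Theory*,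
Ch. II (5.5), (5.7)); nothing here is disputed mathematics and no IUT statement is asserted.

Let `K` be a complete ultrametric normed `ℚ_p`-algebra field, `ϖ` a uniformizer, `e`, `f` its absolute
ramification index and residue degree, `p^m = #μ_{p^∞}(K)` (abc-iut-S8's `torsionPExp`).

* §1 **GAP LEMMA** (any `p`, `m ≥ 1`) `closedBall_ne_zpow_smul_logUnits_of_unif_le_norm`: if some unit
  logarithm `z ∈ log_p(𝒪_K^×)` has `‖z‖ ≥ ‖ϖ‖` (valuation `≤ 1`), then NO ball `{‖y‖ ≤ ‖ϖ‖^j}` equals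
  `p^k · log_p(𝒪_K^×)` — abc-iut-w5-d039's volume identity `m = f·(j − k·e − 1)`
  (`torsionPExp_eq_of_closedBall_eq_zpow_smul_logUnits`, [IUTchIV] Prop. 1.4 (ii)) forces `j − k·e ≥ 2`, while
  `p^k·z ∈ {‖y‖ ≤ ‖ϖ‖^j}` forces `j − k·e ≤ 1`.  At `p = 2`, `m ≥ 1` always (`−1`).
* §2 `p = 2`, **`e` ODD `≥ 3`**: `‖log₂(1 − ϖ^{(e+1)/2})‖ = ‖ϖ‖` EXACTLY (the quadratic term `ϖ^{e+1}/2` of the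
  series is the unique dominant one: abc-iut-w5-d017's `norm_logSeries_eq_zpow_of_dominant`);
* §3 `p = 2`, **`e ≥ 6`**: with `s = ⌊e/4⌋ + 1`, `‖log₂(1 − ϖ^s)‖ = ‖ϖ‖^{4s − 2e} > 1` (the quartic term
  `ϖ^{4s}/4` dominates uniquely since `e/4 < s < e/2`);
* §4 hence at `p = 2`: **`e ≥ 3`, `e ≠ 4` ⇒ no ball is a `2^k · log₂(𝒪_K^×)`**
  (`closedBall_ne_zpow_smul_logUnits_of_three_le`), and the same for **`2 ∣ e`, `f ≥ 2`** (abc-iut-w5-d017's unit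
  with a unit logarithm, `exists_norm_unitLog_eq_one_of_two_dvd`) — `closedBall_ne_zpow_smul_logUnits_of_two_dvd`;
  combined: `closedBall_ne_zpow_smul_logUnits_dyadic` (`e ≥ 2` and NOT (`f = 1` and `e ∈ {2, 4}`)).

With abc-iut-w5-d216 (`e = f = 1`: every ball fixed), abc-iut-w5-d180 (`e = 1`, `f ≥ 2`: none) and this seat's
`UnitLogWildQuadraticDyadicCases` (`e = 2`, `f = 1`: trichotomy by `F_v ∩ √ℚ₂`) this leaves, at `p = 2`, exactly
the local type `(e, f) = (4, 1)` (e.g. `ℚ₂(ζ₈)`, `ℚ₂(2^{1/4})`) undecided for general radii (its unit ball with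
`m = 3` is abc-iut-w5-d039's `closedBall_one_ne_zpow_smul_logUnits_two_of_absRamificationIdx_eq_four`).
Consumer: the abc-iut cell's TEAM R «ismDH mover» thread (`Thm311RealIsmDHMoverCriterion`).
[cite: NeukirchANT1999, Ch. II Prop. (5.5), (5.7)]
-/

noncomputable section

open Metric Set
open scoped Pointwise

namespace Literature.IUT.LogVolume

namespace DyadicNoFixedBall

open RamificationCriterion Literature.NumberTheory.GaloisRepresentations.Ultrametric

/-! ## 1. The gap lemma (any `p`, `m ≥ 1`) -/

section Gap

variable (p : ℕ) [hp : Fact p.Prime] {K : Type*} [NontriviallyNormedField K] [NormedAlgebra ℚ_[p] K]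
  [IsUltrametricDist K] [ProperSpace K]

/-- **GAP LEMMA.** If `m ≥ 1` (`K` has a `p`-th root of unity `≠ 1`) and some `z ∈ log_p(𝒪_K^×)` has
`‖ϖ‖ ≤ ‖z‖`, then `{‖y‖ ≤ ‖ϖ‖^j} ≠ p^k · log_p(𝒪_K^×)` for all `j`, `k` (volume: `m = f·(j − k·e − 1)` needs
`j − k·e ≥ 2`; `p^k·z` in the ball needs `j − k·e ≤ 1`). [cite: NeukirchANT1999, Ch. II Prop. (5.7)] -/
theorem closedBall_ne_zpow_smul_logUnits_of_unif_le_norm (hm : 1 ≤ torsionPExp p K) {ϖ : Kˣ}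
    (hϖ : IsUniformizer ϖ) {z : K} (hz : z ∈ logUnits K) (hzn : ‖(ϖ : K)‖ ≤ ‖z‖) (j k : ℤ) :
    closedBall (0 : K) (‖(ϖ : K)‖ ^ j) ≠ ((p : ℚ_[p]) ^ k) • logUnits K := by
  intro h
  have H := torsionPExp_eq_of_closedBall_eq_zpow_smul_logUnits p K hϖ h
  have hρ0 : 0 < ‖(ϖ : K)‖ := norm_units_pos ϖ
  -- `p^k • z` lies in the ball
  have hmem : ((p : ℚ_[p]) ^ k) • z ∈ closedBall (0 : K) (‖(ϖ : K)‖ ^ j) := h ▸ smul_mem_smul_set hz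
  rw [mem_closedBall_zero_iff, norm_smul, Padic.norm_p_zpow, natCast_prime_eq_zpow p hϖ, ← zpow_mul,
    show -(absRamificationIdx p K : ℤ) * -k = k * (absRamificationIdx p K : ℤ) by ring] at hmem
  have h1 : ‖(ϖ : K)‖ ^ (k * (absRamificationIdx p K : ℤ) + 1) ≤ ‖(ϖ : K)‖ ^ j := by
    rw [zpow_add_one₀ hρ0.ne']
    exact (mul_le_mul_of_nonneg_left hzn (zpow_pos hρ0 _).le).trans hmem
  have hj : j ≤ k * (absRamificationIdx p K : ℤ) + 1 := (zpow_le_zpow_iff_right_of_lt_one₀ hρ0 hϖ.1).mp h1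
  have hf : (1 : ℤ) ≤ residueDegree p K := by exact_mod_cast residueDegree_pos p K
  have hm' : (1 : ℤ) ≤ torsionPExp p K := by exact_mod_cast hm
  have hneg : (residueDegree p K : ℤ) * (j - k * (absRamificationIdx p K : ℤ) - 1) ≤ 0 :=
    mul_nonpos_of_nonneg_of_nonpos (by linarith) (by linarith)
  linarith

/-- Norm form: for `t ≠ 0`, `{‖y‖ ≤ ‖t‖} ≠ p^k · log_p(𝒪_K^×)`. [cite: NeukirchANT1999, Ch. II Prop. (5.7)] -/
theorem closedBall_norm_ne_zpow_smul_logUnits_of_unif_le_norm (hm : 1 ≤ torsionPExp p K) {ϖ : Kˣ}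
    (hϖ : IsUniformizer ϖ) {z : K} (hz : z ∈ logUnits K) (hzn : ‖(ϖ : K)‖ ≤ ‖z‖) {t : K} (ht : t ≠ 0) (k : ℤ) :
    closedBall (0 : K) ‖t‖ ≠ ((p : ℚ_[p]) ^ k) • logUnits K := by
  obtain ⟨j, hj⟩ := hϖ.2 (Units.mk0 t ht)
  rw [Units.val_mk0] at hj
  rw [hj]
  exact closedBall_ne_zpow_smul_logUnits_of_unif_le_norm p hm hϖ hz hzn j k

end Gap

/-! ## 2. `p = 2`, `e` odd `≥ 3`: a unit logarithm of norm EXACTLY `‖ϖ‖` -/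

section Dyadic

variable {K : Type*} [NontriviallyNormedField K] [NormedAlgebra ℚ_[2] K] [IsUltrametricDist K] [ProperSpace K]
  {ϖ : Kˣ} (hϖ : IsUniformizer ϖ)

/-- `b + 1 ≤ 2^b`. [folklore] -/
private theorem succ_le_two_pow (b : ℕ) : (b : ℤ) + 1 ≤ (2 : ℤ) ^ b := by
  have h : b < 2 ^ b := Nat.lt_two_pow_self
  exact_mod_cast h

omit [NormedAlgebra ℚ_[2] K] [IsUltrametricDist K] [ProperSpace K] in
/-- The principal unit `1 − ϖ^s` (`s ≥ 1`): `‖1 − (1 − ϖ^s)‖ = ‖ϖ‖^s`. [cite: NeukirchANT1999, Ch. II Prop. (5.3)] -/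
theorem norm_one_sub_one_sub_pow (s : ℕ) : ‖1 - (1 - (ϖ : K) ^ s)‖ = ‖(ϖ : K)‖ ^ (s : ℤ) := by
  rw [sub_sub_cancel, norm_pow, zpow_natCast]

omit [NormedAlgebra ℚ_[2] K] [IsUltrametricDist K] [ProperSpace K] in
include hϖ in
/-- `1 − ϖ^s` is a principal unit for `s ≥ 1`. [cite: NeukirchANT1999, Ch. II Prop. (5.3)] -/
theorem isPrincipal_one_sub_pow {s : ℕ} (hs : 1 ≤ s) : IsPrincipal (1 - (ϖ : K) ^ s) := by
  show ‖1 - (1 - (ϖ : K) ^ s)‖ < 1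
  rw [sub_sub_cancel, norm_pow]
  exact pow_lt_one₀ (norm_nonneg _) hϖ.1 (by omega)

include hϖ in
/-- **`e` odd, `e ≥ 3`, `s = (e+1)/2`: `‖L(1 − ϖ^s)‖ = ‖ϖ‖`** — the quadratic term `ϖ^{2s}/2` has exponent
`2s − e = 1`, every other term exponent `≥ 2`. [cite: NeukirchANT1999, Ch. II Prop. (5.5)] -/
theorem norm_logSeries_one_sub_pow_of_odd (he3 : 3 ≤ absRamificationIdx 2 K) (hodd : Odd (absRamificationIdx 2 K)) :
    ‖logSeries (1 - (ϖ : K) ^ ((absRamificationIdx 2 K + 1) / 2))‖ = ‖(ϖ : K)‖ := by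
  set e := absRamificationIdx 2 K with hedef
  set s := (e + 1) / 2 with hsdef
  have hs2 : 2 * s = e + 1 := by obtain ⟨r, hr⟩ := hodd; omega
  have hs1 : 1 ≤ s := by omega
  have hsZ : (1 : ℤ) ≤ s := by exact_mod_cast hs1
  have hy := norm_one_sub_one_sub_pow (ϖ := ϖ) s
  have h := norm_logSeries_eq_zpow_of_dominant 2 hϖ (isPrincipal_one_sub_pow hϖ hs1) hy 1 (N₀ := 1) ?_ ?_
  · rw [h, zpow_one]
  · -- the quadratic term: `s·2 − e·v₂(2) = 2s − e = 1`
    have hv : padicValNat 2 (1 + 1) = 1 := by norm_num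
    rw [hv]; push_cast; omega
  · intro n hn
    rw [← hedef]
    obtain ⟨a, hle, hstrict⟩ := exists_exponent_le_index (p := 2) hsZ e (n := n + 1) (by omega)
    have heZ : (3 : ℤ) ≤ e := by exact_mod_cast he3
    have hsZ' : (2 : ℤ) * s = e + 1 := by exact_mod_cast hs2
    -- `h(a) = s·2^a − e·a ≥ 2` for `a ≠ 1`, and `h(1) + 1 = 2`
    rcases Nat.lt_or_ge a 3 with ha | ha
    · interval_cases a
      · -- `a = 0`: `h(0) = s ≥ 2`
        simp only [pow_zero, mul_one, Nat.cast_zero, mul_zero, sub_zero, Nat.cast_add, Nat.cast_one] at hle ⊢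
        linarith
      · -- `a = 1`: `n + 1 ≠ 2`, so `h(1) + 1 ≤ N`
        have hne : n + 1 ≠ 2 ^ 1 := by omega
        have h2 := hstrict hne
        simp only [pow_one, Nat.cast_one, mul_one, Nat.cast_ofNat, Nat.cast_add] at h2 ⊢
        linarith
      · -- `a = 2`: `h(2) = 4s − 2e = 2`
        simp only [Nat.cast_ofNat, Nat.cast_add, Nat.cast_one] at hle ⊢
        norm_num at hle
        linarith
    · -- `a ≥ 3`: `h(a) = (e+1)·2^{a-1}·… ≥ e + 4`
      obtain ⟨b, rfl⟩ := Nat.exists_eq_add_of_le ha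
      have hb := succ_le_two_pow b
      simp only [Nat.cast_ofNat, Nat.cast_add, Nat.cast_one, pow_add] at hle ⊢
      norm_num at hle
      -- hle : ↑s * (8 * 2 ^ b) ≤ RHS + ↑e * (3 + ↑b)  (up to normalisation)
      have he0 : (0 : ℤ) ≤ e := by linarith
      have hb0 : (0 : ℤ) ≤ b := by positivity
      have E1 : (s : ℤ) * 2 ^ b * 2 = (e + 1) * 2 ^ b := by
        rw [show (s : ℤ) * 2 ^ b * 2 = (2 * s) * 2 ^ b by ring, hsZ']
      have E2 : (e : ℤ) * (b + 1) ≤ e * 2 ^ b := mul_le_mul_of_nonneg_left hb he0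
      have E5 : (0 : ℤ) ≤ e * b := mul_nonneg he0 hb0
      linarith [E1, E2, E5, hb, heZ]

include hϖ in
/-- **`e` odd `≥ 3` ⇒ a unit whose logarithm has norm EXACTLY `‖ϖ‖`** (`u = 1 − ϖ^{(e+1)/2}`).
[cite: NeukirchANT1999, Ch. II Prop. (5.5)] -/
theorem exists_norm_unitLog_eq_unif_of_odd (he3 : 3 ≤ absRamificationIdx 2 K) (hodd : Odd (absRamificationIdx 2 K)) :
    ∃ u : K, ‖u‖ = 1 ∧ ‖unitLog u‖ = ‖(ϖ : K)‖ := by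
  have hs1 : 1 ≤ (absRamificationIdx 2 K + 1) / 2 := by omega
  have hP := isPrincipal_one_sub_pow hϖ hs1
  exact ⟨_, hP.norm_eq_one, by rw [unitLog_of_isPrincipal 2 hP, norm_logSeries_one_sub_pow_of_odd hϖ he3 hodd]⟩

/-! ## 3. `p = 2`, `e ≥ 6`: a unit logarithm of norm `‖ϖ‖^{4s − 2e} > 1` -/

include hϖ in
/-- **`e ≥ 6`, `s = ⌊e/4⌋ + 1`: `‖L(1 − ϖ^s)‖ = ‖ϖ‖^{4s − 2e}`** — the quartic term `ϖ^{4s}/4` has exponent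
`4s − 2e ≤ −2`, every other term exponent `≥ 4s − 2e + 1` (because `e/4 < s` and `2s + 1 ≤ e`).
[cite: NeukirchANT1999, Ch. II Prop. (5.5)] -/
theorem norm_logSeries_one_sub_pow_of_six_le (he6 : 6 ≤ absRamificationIdx 2 K) :
    ‖logSeries (1 - (ϖ : K) ^ (absRamificationIdx 2 K / 4 + 1))‖ =
      ‖(ϖ : K)‖ ^ (4 * ((absRamificationIdx 2 K / 4 + 1 : ℕ) : ℤ) - 2 * (absRamificationIdx 2 K : ℤ)) := by
  set e := absRamificationIdx 2 K with hedef
  set s := e / 4 + 1 with hsdef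
  have hs4 : 4 * s ≤ e + 4 := by omega
  have hs4' : e + 1 ≤ 4 * s := by omega
  have hs1 : 1 ≤ s := by omega
  have hsZ : (1 : ℤ) ≤ s := by exact_mod_cast hs1
  have heZ : (6 : ℤ) ≤ e := by exact_mod_cast he6
  have hs4Z : (4 : ℤ) * s ≤ e + 4 := by exact_mod_cast hs4
  have hs4Z' : (e : ℤ) + 1 ≤ 4 * s := by exact_mod_cast hs4'
  have hy := norm_one_sub_one_sub_pow (ϖ := ϖ) s
  refine norm_logSeries_eq_zpow_of_dominant 2 hϖ (isPrincipal_one_sub_pow hϖ hs1) hy 3 ?_ ?_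
  · -- the quartic term: `s·4 − e·v₂(4) = 4s − 2e`
    have hv : padicValNat 2 (3 + 1) = 2 := by
      rw [show (3 + 1 : ℕ) = 2 ^ 2 by norm_num, padicValNat.prime_pow]
    rw [hv]; push_cast; ring
  · intro n hn
    rw [← hedef]
    obtain ⟨a, hle, hstrict⟩ := exists_exponent_le_index (p := 2) hsZ e (n := n + 1) (by omega)
    rcases Nat.lt_or_ge a 3 with ha | ha
    · interval_cases a
      · -- `a = 0`: `h(0) = s ≥ 4s − 2e + 1`
        simp only [pow_zero, mul_one, Nat.cast_zero, mul_zero, sub_zero, Nat.cast_add, Nat.cast_one] at hle ⊢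
        linarith
      · -- `a = 1`: `h(1) = 2s − e ≥ 4s − 2e + 1`
        simp only [pow_one, Nat.cast_one, mul_one, Nat.cast_ofNat, Nat.cast_add] at hle ⊢
        linarith
      · -- `a = 2`: `n + 1 ≠ 4`, so `h(2) + 1 ≤ N`
        have hne : n + 1 ≠ 2 ^ 2 := by omega
        have h2 := hstrict hne
        simp only [Nat.cast_ofNat, Nat.cast_add, Nat.cast_one] at h2 ⊢
        norm_num at h2
        linarith
    · -- `a ≥ 3`: `h(a) = s·2^a − e·a ≥ 4s − 2e + 1`
      obtain ⟨b, rfl⟩ := Nat.exists_eq_add_of_le ha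
      have hb := succ_le_two_pow b
      simp only [Nat.cast_ofNat, Nat.cast_add, Nat.cast_one, pow_add] at hle ⊢
      norm_num at hle
      have he0 : (0 : ℤ) ≤ e := by linarith
      have hb0 : (0 : ℤ) ≤ b := by positivity
      have hT1 : (0 : ℤ) ≤ 2 * 2 ^ b - 1 := by linarith
      have E1 : ((e : ℤ) + 1) * (2 * 2 ^ b - 1) ≤ (4 * s) * (2 * 2 ^ b - 1) :=
        mul_le_mul_of_nonneg_right hs4Z' hT1
      have E2 : (e : ℤ) * (b + 1) ≤ e * 2 ^ b := mul_le_mul_of_nonneg_left hb he0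
      have E5 : (0 : ℤ) ≤ e * b := mul_nonneg he0 hb0
      linarith [E1, E2, E5, hb, heZ]

include hϖ in
/-- **`e ≥ 6` ⇒ a unit whose logarithm has norm `≥ ‖ϖ‖`** (indeed `> 1`: `u = 1 − ϖ^{⌊e/4⌋+1}`).
[cite: NeukirchANT1999, Ch. II Prop. (5.5)] -/
theorem exists_unif_le_norm_unitLog_of_six_le (he6 : 6 ≤ absRamificationIdx 2 K) :
    ∃ u : K, ‖u‖ = 1 ∧ ‖(ϖ : K)‖ ≤ ‖unitLog u‖ := by
  set e := absRamificationIdx 2 K with hedef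
  have hs1 : 1 ≤ e / 4 + 1 := by omega
  have hP := isPrincipal_one_sub_pow hϖ hs1
  refine ⟨_, hP.norm_eq_one, ?_⟩
  rw [unitLog_of_isPrincipal 2 hP, norm_logSeries_one_sub_pow_of_six_le hϖ he6]
  have hexp : (4 : ℤ) * ((e / 4 + 1 : ℕ) : ℤ) - 2 * (e : ℤ) ≤ 1 := by omega
  calc ‖(ϖ : K)‖ = ‖(ϖ : K)‖ ^ (1 : ℤ) := (zpow_one _).symm
    _ ≤ _ := zpow_le_zpow_right_of_le_one₀ (norm_units_pos ϖ) hϖ.1.le hexp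

/-! ## 4. No ball is a `2^k · log₂(𝒪_K^×)` -/

include hϖ in
/-- **`p = 2`, `e` odd `≥ 3` ⇒ `{‖y‖ ≤ ‖ϖ‖^j} ≠ 2^k · log₂(𝒪_K^×)` for all `j`, `k`.**
[cite: NeukirchANT1999, Ch. II Prop. (5.5), (5.7)] -/
theorem closedBall_ne_zpow_smul_logUnits_of_odd (he3 : 3 ≤ absRamificationIdx 2 K)
    (hodd : Odd (absRamificationIdx 2 K)) (j k : ℤ) :
    closedBall (0 : K) (‖(ϖ : K)‖ ^ j) ≠ ((2 : ℚ_[2]) ^ k) • logUnits K := by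
  obtain ⟨u, hu, hlog⟩ := exists_norm_unitLog_eq_unif_of_odd hϖ he3 hodd
  have h := closedBall_ne_zpow_smul_logUnits_of_unif_le_norm 2 (one_le_torsionPExp_of_two 2 K rfl) hϖ
    (unitLog_mem_logUnits hu) hlog.ge j k
  simpa only [Nat.cast_ofNat] using h

include hϖ in
/-- **`p = 2`, `e ≥ 6` ⇒ `{‖y‖ ≤ ‖ϖ‖^j} ≠ 2^k · log₂(𝒪_K^×)` for all `j`, `k`.**
[cite: NeukirchANT1999, Ch. II Prop. (5.5), (5.7)] -/
theorem closedBall_ne_zpow_smul_logUnits_of_six_le (he6 : 6 ≤ absRamificationIdx 2 K) (j k : ℤ) :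
    closedBall (0 : K) (‖(ϖ : K)‖ ^ j) ≠ ((2 : ℚ_[2]) ^ k) • logUnits K := by
  obtain ⟨u, hu, hlog⟩ := exists_unif_le_norm_unitLog_of_six_le hϖ he6
  have h := closedBall_ne_zpow_smul_logUnits_of_unif_le_norm 2 (one_le_torsionPExp_of_two 2 K rfl) hϖ
    (unitLog_mem_logUnits hu) hlog j k
  simpa only [Nat.cast_ofNat] using h

include hϖ in
/-- **`p = 2`, `e ≥ 3`, `e ≠ 4` ⇒ `{‖y‖ ≤ ‖ϖ‖^j} ≠ 2^k · log₂(𝒪_K^×)` for all `j`, `k`** (`e ∈ {3, 5}` odd, or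
`e ≥ 6`). [cite: NeukirchANT1999, Ch. II Prop. (5.5), (5.7)] -/
theorem closedBall_ne_zpow_smul_logUnits_of_three_le (he3 : 3 ≤ absRamificationIdx 2 K)
    (he4 : absRamificationIdx 2 K ≠ 4) (j k : ℤ) :
    closedBall (0 : K) (‖(ϖ : K)‖ ^ j) ≠ ((2 : ℚ_[2]) ^ k) • logUnits K := by
  by_cases h6 : 6 ≤ absRamificationIdx 2 K
  · exact closedBall_ne_zpow_smul_logUnits_of_six_le hϖ h6 j k
  · refine closedBall_ne_zpow_smul_logUnits_of_odd hϖ he3 ?_ j k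
    have h35 : absRamificationIdx 2 K = 3 ∨ absRamificationIdx 2 K = 5 := by omega
    rcases h35 with h | h <;> rw [h] <;> decide

include hϖ in
/-- **`p = 2`, `2 ∣ e`, `f ≥ 2` ⇒ `{‖y‖ ≤ ‖ϖ‖^j} ≠ 2^k · log₂(𝒪_K^×)` for all `j`, `k`** (abc-iut-w5-d017: a unit
with a unit logarithm; `1 ≥ ‖ϖ‖`). [cite: NeukirchANT1999, Ch. II Prop. (5.5), (5.7)] -/
theorem closedBall_ne_zpow_smul_logUnits_of_two_dvd (he : 2 ∣ absRamificationIdx 2 K)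
    (hf : 2 ≤ residueDegree 2 K) (j k : ℤ) :
    closedBall (0 : K) (‖(ϖ : K)‖ ^ j) ≠ ((2 : ℚ_[2]) ^ k) • logUnits K := by
  obtain ⟨u, hu, hlog⟩ := exists_norm_unitLog_eq_one_of_two_dvd he hf
  have h := closedBall_ne_zpow_smul_logUnits_of_unif_le_norm 2 (one_le_torsionPExp_of_two 2 K rfl) hϖ
    (unitLog_mem_logUnits hu) (by rw [hlog]; exact hϖ.1.le) j k
  simpa only [Nat.cast_ofNat] using h

include hϖ in
/-- **THE DYADIC TABLE, deep part.**  At `p = 2` with `e ≥ 2`: unless `f = 1` and `e ∈ {2, 4}`, NO ball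
`{‖y‖ ≤ ‖ϖ‖^j}` is a `2^k · log₂(𝒪_K^×)` (so, by the cell's ball-mover criterion, Dupuy–Hilado's (Ind2) moves every
ball).  The excluded types: `(e, f) = (2, 1)` is this seat's trichotomy (`UnitLogWildQuadraticDyadicCases`);
`(e, f) = (4, 1)` is left open here. [cite: NeukirchANT1999, Ch. II Prop. (5.5), (5.7)] -/
theorem closedBall_ne_zpow_smul_logUnits_dyadic (he2 : 2 ≤ absRamificationIdx 2 K)
    (hnot : ¬ (residueDegree 2 K = 1 ∧ (absRamificationIdx 2 K = 2 ∨ absRamificationIdx 2 K = 4))) (j k : ℤ) :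
    closedBall (0 : K) (‖(ϖ : K)‖ ^ j) ≠ ((2 : ℚ_[2]) ^ k) • logUnits K := by
  by_cases hf : 2 ≤ residueDegree 2 K
  · rcases Nat.even_or_odd (absRamificationIdx 2 K) with heven | hodd
    · exact closedBall_ne_zpow_smul_logUnits_of_two_dvd hϖ (even_iff_two_dvd.mp heven) hf j k
    · refine closedBall_ne_zpow_smul_logUnits_of_odd hϖ ?_ hodd j k
      obtain ⟨r, hr⟩ := hodd
      omega
  · have hf1 : residueDegree 2 K = 1 := by have := residueDegree_pos 2 K; omega
    refine closedBall_ne_zpow_smul_logUnits_of_three_le hϖ ?_ ?_ j k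
    · by_contra h3
      exact hnot ⟨hf1, Or.inl (by omega)⟩
    · intro h4
      exact hnot ⟨hf1, Or.inr h4⟩

include hϖ in
/-- Norm form of the table: for `t ≠ 0`, `{‖y‖ ≤ ‖t‖} ≠ 2^k · log₂(𝒪_K^×)`.
[cite: NeukirchANT1999, Ch. II Prop. (5.5), (5.7)] -/
theorem closedBall_norm_ne_zpow_smul_logUnits_dyadic (he2 : 2 ≤ absRamificationIdx 2 K)
    (hnot : ¬ (residueDegree 2 K = 1 ∧ (absRamificationIdx 2 K = 2 ∨ absRamificationIdx 2 K = 4))) {t : K}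
    (ht : t ≠ 0) (k : ℤ) : closedBall (0 : K) ‖t‖ ≠ ((2 : ℚ_[2]) ^ k) • logUnits K := by
  obtain ⟨j, hj⟩ := hϖ.2 (Units.mk0 t ht)
  rw [Units.val_mk0] at hj
  rw [hj]
  exact closedBall_ne_zpow_smul_logUnits_dyadic hϖ he2 hnot j k

end Dyadic

end DyadicNoFixedBall

end Literature.IUT.LogVolume

end
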